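import Literature.Barriers.CriticalPhenomena.PositionSpaceRGNonGibbsianChessboard
import HarnessLib

/-!
# The abstract chessboard estimate on a block torus of ODD side

Companion of `Literature.Probability.LatticeModels.ChessboardEstimateEvenTorus` (every EVEN side) and of the tree's
dyadic original `Literature.Barriers.CriticalPhenomena.NonGibbs.chessboard_pow_le`.  On the block torus `(ℤ/Nℤ)^d` with
`N = 2S + 1` ODD, `N ≥ 3`, every reflection `cᵢ ↦ 1 - cᵢ` of an axis fixes ONE block (`cᵢ = S + 1`, as `2(S+1) ≡ 1`)
besides the block boundary `0 | 1`; the two CLOSED half-lines `{1, …, S+1}` and `{S+1, …, 2S, 0}` overlap in that block.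
For a non-negative set function `ψ` on sets of blocks with `ψ ∅ ≤ 1`, `ψ univ > 0`, invariant under the unit translations
of every axis, and obeying the reflection Cauchy–Schwarz inequalities with the CLOSED-half symmetrisations
`ψ A ^ 2 ≤ ψ (csymP i A) · ψ (symM i 1 A)` (`csymP i A = (A ∩ C₊) ∪ θ(A ∩ C₊)`, `C₊` the closed positive half-line;
`symM i 1` is the tree's negative symmetrisation, whose half `{(cᵢ - 1).val ≥ N/2}` is automatically the closed negative
half-line when `N` is odd), we prove `ψ A ^ (N^d) ≤ ψ univ ^ #A` for every `A` (`chessboard_pow_le_odd`) and the usual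
form `ψ A ≤ (ψ univ) ^ (#A / N^d)` (`chessboard_le_rpow_odd`).

This is the situation of reflection positivity on a torus of odd period (one hyperplane through sites and one between
sites per reflection), e.g. the Wilson lattice gauge theory on the odd tori `(ℤ/(2S+1))^d`
(`Literature.MathematicalPhysics.QuantumFieldTheory.wilsonExpectation_oddReflectionPositive`): an observable sitting on
the fixed block is shared by both factors of the Schwarz inequality, which is why the closed halves appear.

Proof: the Fröhlich–Israel–Lieb–Simon maximisation argument (CMP 62 (1978), proofs of Thm. 2.2 / Thm. 4.1), which —
unlike the `2ⁿ`-fold iterated Schwarz inequality — runs on odd cycles: a maximiser `A*` of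
`Φ A = ψ A ^ (N^d) / ψ univ ^ #A` stays a maximiser under the closed positive symmetrisation of every axis (Schwarz +
`#csymP A + #symM A = 2 #A`) and under translations; along one axis, the run-doubling walk `σ ↦ rot₋ℓ (σ⁺)` on the
assignment `t ↦ (slice t of A*)` of the odd cycle `ℤ/(2S+1)` reaches a CONSTANT assignment (`OddChessboard.walk`), i.e. a
maximiser that is a cylinder over a slice of `A*`; iterating over the `d` axes from a non-empty maximiser yields the
maximiser `univ`, where `Φ = 1`.  The one-dimensional combinatorics (`plusHalf`, `walk`) is adapted from the tree's
`Summit.QuantumFields.QCD.Cruxes.WindowExtinction.ChessboardColdCells.OddCycle` (crux support file, not importable from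
`Literature`), generalised from assignments to sets of blocks in `d` dimensions.

## Main results

* `csymP`, `chalfPlus` — the closed positive half-line `{1, …, N/2 + 1}` of axis `i` and the symmetrisation in it.
* `card_csymP_add_card_symM_odd` — `#csymP i A + #symM i 1 A = 2 #A` for odd `N`.
* `OddChessboard.walk` — the run-doubling walk on assignments of the odd cycle.
* `chessboard_pow_le_odd`, `chessboard_le_rpow_odd` — the chessboard estimate for every odd side `N ≥ 3`.

What is NOT here: any measure theory (the Schwarz inequalities are hypotheses; the reflection-positivity layer for the
Wilson action on odd tori is in the `Summits/QuantumFields/YangMills/Theorems/…OddTorusChessboard…` files), and the even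
case (see the companion file).

## References

* J. Fröhlich, R. Israel, E. H. Lieb, B. Simon, Comm. Math. Phys. 62 (1978) 1–34, Thm. 2.2 (proof by maximisation) and
  Thm. 4.1 [FrohlichIsraelLiebSimon1978].
* S. Friedli, Y. Velenik, *Statistical Mechanics of Lattice Systems*, CUP 2017, Theorem 10.11 [FriedliVelenik2017].
* M. Biskup, LNM 1970 (2009), Thm. 5.8 [Biskup2009].
-/

noncomputable section

namespace Literature.Probability.LatticeModels

open Finset
open Literature.Barriers.CriticalPhenomena.NonGibbs

/-! ### §1. The run-doubling walk on assignments of the odd cycle `ℤ/(2S+1)` -/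

namespace OddChessboard

variable {S : ℕ} {ι : Type*}

/-- The closed positive half `1 ≤ t ≤ S + 1` of the cycle `ℤ/(2S+1)` (the open half `1 ≤ t ≤ S` together with the
vertex `S + 1` fixed by the reflection `t ↦ 1 - t`), as a `Finset`.
[cite: FrohlichIsraelLiebSimon1978, Thm. 2.2 (proof)] -/
def cPlus (S : ℕ) : Finset (ZMod (2 * S + 1)) :=
  Finset.univ.filter fun t => t.val ≠ 0 ∧ t.val ≤ S + 1

/-- The open positive half `1 ≤ t ≤ S` of the cycle `ℤ/(2S+1)`, as a `Finset`.
[cite: FrohlichIsraelLiebSimon1978, Thm. 2.2 (proof)] -/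
def cMinus (S : ℕ) : Finset (ZMod (2 * S + 1)) :=
  Finset.univ.filter fun t => t.val ≠ 0 ∧ t.val ≤ S

/-- Membership in the closed positive half. [cite: FrohlichIsraelLiebSimon1978, Thm. 2.2 (proof)] -/
theorem mem_cPlus {t : ZMod (2 * S + 1)} : t ∈ cPlus S ↔ t.val ≠ 0 ∧ t.val ≤ S + 1 := by
  simp [cPlus]

/-- Membership in the open positive half. [cite: FrohlichIsraelLiebSimon1978, Thm. 2.2 (proof)] -/
theorem mem_cMinus {t : ZMod (2 * S + 1)} : t ∈ cMinus S ↔ t.val ≠ 0 ∧ t.val ≤ S := by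
  simp [cMinus]

/-- Keep the closed positive half of an assignment and reflect it (`t ↦ 1 - t`) onto the rest.
[cite: FrohlichIsraelLiebSimon1978, Thm. 2.2 (proof)] -/
def plusHalf (σ : ZMod (2 * S + 1) → ι) : ZMod (2 * S + 1) → ι :=
  fun t => if t ∈ cPlus S then σ t else σ (1 - t)

/-- Keep the closed negative half of an assignment and reflect it onto the open positive half.
[cite: FrohlichIsraelLiebSimon1978, Thm. 2.2 (proof)] -/
def minusHalf (σ : ZMod (2 * S + 1) → ι) : ZMod (2 * S + 1) → ι :=
  fun t => if t ∈ cMinus S then σ (1 - t) else σ t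

/-- Master formula for the value of a difference of two small naturals in `ℤ/(2S+1)`. [folklore] -/
private theorem val_natCast_sub_natCast {a b : ℕ} (ha : a < 2 * S + 1) (hb : b < 2 * S + 1) :
    ((a : ZMod (2 * S + 1)) - (b : ZMod (2 * S + 1))).val =
      if b ≤ a then a - b else a + (2 * S + 1) - b := by
  split_ifs with h
  · rw [← Nat.cast_sub h, ZMod.val_cast_of_lt (by omega)]
  · have : (a : ZMod (2 * S + 1)) - (b : ZMod (2 * S + 1)) = ((a + (2 * S + 1) - b : ℕ) : ZMod _) := by
      rw [sub_eq_iff_eq_add, ← Nat.cast_add, Nat.sub_add_cancel (by omega), Nat.cast_add,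
        ZMod.natCast_self, add_zero]
    rw [this, ZMod.val_cast_of_lt (by omega)]

/-- The value of `1 - t` in `ℤ/(2S+1)`, `S ≥ 1`. [folklore] -/
private theorem val_one_sub (hS : 1 ≤ S) (t : ZMod (2 * S + 1)) :
    (1 - t).val = if t.val ≤ 1 then 1 - t.val else 1 + (2 * S + 1) - t.val := by
  have : (1 : ZMod (2 * S + 1)) - t = ((1 : ℕ) : ZMod _) - (t.val : ZMod _) := by
    rw [ZMod.natCast_zmod_val, Nat.cast_one]
  rw [this]
  exact val_natCast_sub_natCast (by omega) (ZMod.val_lt t)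

/-- The value of `t - ℓ` in `ℤ/(2S+1)` for a small natural `ℓ`. [folklore] -/
private theorem val_sub_natCast {ℓ : ℕ} (hℓ : ℓ < 2 * S + 1) (t : ZMod (2 * S + 1)) :
    (t - (ℓ : ZMod (2 * S + 1))).val = if ℓ ≤ t.val then t.val - ℓ else t.val + (2 * S + 1) - ℓ := by
  conv_lhs => rw [← ZMod.natCast_zmod_val t]
  exact val_natCast_sub_natCast (ZMod.val_lt t) hℓ

/-- The value of `1 - (t - ℓ) = (1 + ℓ) - t` in `ℤ/(2S+1)` for `1 + ℓ < 2S+1`. [folklore] -/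
private theorem val_one_sub_sub_natCast {ℓ : ℕ} (hℓ : 1 + ℓ < 2 * S + 1) (t : ZMod (2 * S + 1)) :
    (1 - (t - (ℓ : ZMod (2 * S + 1)))).val =
      if t.val ≤ 1 + ℓ then 1 + ℓ - t.val else 1 + ℓ + (2 * S + 1) - t.val := by
  have : (1 : ZMod (2 * S + 1)) - (t - (ℓ : ZMod (2 * S + 1))) =
      ((1 + ℓ : ℕ) : ZMod _) - (t.val : ZMod _) := by
    rw [ZMod.natCast_zmod_val, Nat.cast_add, Nat.cast_one]; ring
  rw [this]
  exact val_natCast_sub_natCast hℓ (ZMod.val_lt t)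

/-- The open half lies in the closed half. [folklore] -/
private theorem cPlus_of_cMinus {t : ZMod (2 * S + 1)} (h : t ∈ cMinus S) : t ∈ cPlus S :=
  mem_cPlus.2 ⟨(mem_cMinus.1 h).1, (mem_cMinus.1 h).2.trans (Nat.le_succ S)⟩

/-- The reflection fixes the vertex `S + 1`. [folklore] -/
private theorem one_sub_eq_self (hS : 1 ≤ S) {t : ZMod (2 * S + 1)} (hp : t ∈ cPlus S) (hm : t ∉ cMinus S) :
    1 - t = t := by
  have hv : t.val = S + 1 := by
    rw [mem_cPlus] at hp; rw [mem_cMinus] at hm; omega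
  apply ZMod.val_injective
  rw [val_one_sub hS, hv, if_neg (by omega)]
  omega

/-- Outside the closed positive half, the reflected point lies in the open positive half. [folklore] -/
private theorem one_sub_mem_cMinus_of_not_mem_cPlus (hS : 1 ≤ S) {t : ZMod (2 * S + 1)} (h : t ∉ cPlus S) :
    1 - t ∈ cMinus S := by
  have hv := val_one_sub hS t
  have ht := ZMod.val_lt t
  rw [mem_cPlus, not_and_or, not_not, not_le] at h
  rw [mem_cMinus]
  rcases h with h | h
  · rw [h, if_pos (by omega)] at hv
    omega
  · rw [if_neg (by omega)] at hv
    omega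

/-- Inside the open positive half, the reflected point lies outside the closed positive half. [folklore] -/
private theorem one_sub_not_mem_cPlus_of_mem_cMinus (hS : 1 ≤ S) {t : ZMod (2 * S + 1)} (h : t ∈ cMinus S) :
    1 - t ∉ cPlus S := by
  have hv := val_one_sub hS t
  have ht := ZMod.val_lt t
  rw [mem_cMinus] at h
  rw [mem_cPlus, not_and_or, not_not, not_le]
  by_cases h1 : t.val ≤ 1
  · rw [if_pos h1] at hv
    left; omega
  · rw [if_neg h1] at hv
    right; omega

/-- A run `τ = k` on `1 ≤ t ≤ ℓ` with `ℓ ≥ S + 1` makes `plusHalf τ` constant.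
[cite: FrohlichIsraelLiebSimon1978, Thm. 2.2 (proof)] -/
theorem plusHalf_eq_const_of_run (hS : 1 ≤ S) {τ : ZMod (2 * S + 1) → ι} {k : ι} {ℓ : ℕ}
    (hrun : ∀ t : ZMod (2 * S + 1), t.val ≠ 0 → t.val ≤ ℓ → τ t = k) (hℓ : S + 1 ≤ ℓ) :
    plusHalf τ = fun _ => k := by
  funext t
  unfold plusHalf
  split_ifs with h
  · exact hrun t (mem_cPlus.1 h).1 ((mem_cPlus.1 h).2.trans hℓ)
  · have hv := val_one_sub hS t
    have ht := ZMod.val_lt t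
    rw [mem_cPlus] at h
    refine hrun _ ?_ ?_
    · split_ifs at hv with h1 <;> omega
    · split_ifs at hv with h1 <;> omega

/-- Run doubling: a run `τ = k` on `1 ≤ t ≤ ℓ`, `ℓ ≤ S`, becomes the run `1 ≤ t ≤ 2ℓ` of the rotate
`t ↦ plusHalf τ (t - ℓ)`. [cite: FrohlichIsraelLiebSimon1978, Thm. 2.2 (proof)] -/
theorem plusHalf_sub_of_run (hS : 1 ≤ S) {τ : ZMod (2 * S + 1) → ι} {k : ι} {ℓ : ℕ}
    (hrun : ∀ t : ZMod (2 * S + 1), t.val ≠ 0 → t.val ≤ ℓ → τ t = k) (hℓ1 : 1 ≤ ℓ) (hℓS : ℓ ≤ S)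
    (t : ZMod (2 * S + 1)) (ht0 : t.val ≠ 0) (ht : t.val ≤ 2 * ℓ) :
    plusHalf τ (t - (ℓ : ZMod (2 * S + 1))) = k := by
  have hv := val_sub_natCast (show ℓ < 2 * S + 1 by omega) t
  have hv' := val_one_sub_sub_natCast (show 1 + ℓ < 2 * S + 1 by omega) t
  have htl := ZMod.val_lt t
  unfold plusHalf
  split_ifs with h
  · rw [mem_cPlus] at h
    refine hrun _ h.1 ?_
    split_ifs at hv with h1 <;> omega
  · rw [mem_cPlus] at h
    refine hrun _ ?_ ?_
    · split_ifs at hv with h1 <;> split_ifs at hv' with h2 <;> omega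
    · split_ifs at hv with h1 <;> split_ifs at hv' with h2 <;> omega

/-- **The run-doubling walk.** A property of assignments of the odd cycle `ℤ/(2S+1)` that is stable under `plusHalf`
and under rotations passes from an assignment to each of its constant assignments.
[cite: FrohlichIsraelLiebSimon1978, Thm. 2.2 (proof)] -/
theorem walk (hS : 1 ≤ S) {P : (ZMod (2 * S + 1) → ι) → Prop}
    (hplus : ∀ σ, P σ → P (plusHalf σ))
    (hrot : ∀ σ (a : ZMod (2 * S + 1)), P σ → P (fun t => σ (t + a)))
    {σ : ZMod (2 * S + 1) → ι} (hσ : P σ) (t₀ : ZMod (2 * S + 1)) : P (fun _ => σ t₀) := by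
  suffices key : ∀ (fuel ℓ : ℕ) (τ : ZMod (2 * S + 1) → ι) (k : ι), P τ → 1 ≤ ℓ →
      2 * S + 1 ≤ ℓ + fuel → (∀ t : ZMod (2 * S + 1), t.val ≠ 0 → t.val ≤ ℓ → τ t = k) →
      P (fun _ => k) by
    refine key (2 * S + 1) 1 (fun t => σ (t + (t₀ - 1))) (σ t₀) (hrot σ _ hσ) le_rfl (by omega) ?_
    intro t ht0 ht1
    have h1 : t = 1 := by
      rw [← ZMod.natCast_zmod_val t, show t.val = 1 by omega, Nat.cast_one]
    simp [h1]
  intro fuel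
  induction fuel with
  | zero =>
      intro ℓ τ k hτ _ hN hrun
      rw [← plusHalf_eq_const_of_run hS hrun (by omega)]
      exact hplus τ hτ
  | succ n ih =>
      intro ℓ τ k hτ hℓ hN hrun
      by_cases hℓS : S + 1 ≤ ℓ
      · rw [← plusHalf_eq_const_of_run hS hrun hℓS]
        exact hplus τ hτ
      · refine ih (2 * ℓ) (fun t => plusHalf τ (t + -((ℓ : ℕ) : ZMod (2 * S + 1)))) k
          (hrot _ _ (hplus τ hτ)) (by omega) (by omega) ?_
        intro t ht0 ht
        show plusHalf τ (t + -((ℓ : ℕ) : ZMod (2 * S + 1))) = k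
        rw [← sub_eq_add_neg]
        exact plusHalf_sub_of_run hS hrun hℓ (by omega) t ht0 ht

end OddChessboard

/-! ### §2. Blocks of the odd torus: closed positive half, symmetrisation, translations, gluing slices -/

section Blocks

variable {d N : ℕ} [NeZero N]

variable (N) in
/-- **The CLOSED positive half-line of axis `i`** for the reflection `cᵢ ↦ 1 - cᵢ` through the block boundary `0 | 1`:
the blocks with `cᵢ ∈ {1, …, N/2 + 1}`.  For odd `N = 2S+1` this is the open half `{1, …, S}` (the tree's
`halfPlus N i 1`) together with the FIXED block `cᵢ = S + 1`. [cite: FrohlichIsraelLiebSimon1978, Thm. 2.2 (proof)] -/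
def chalfPlus (i : Fin d) : Finset (BlockIdx d N) :=
  univ.filter fun c => (c i).val ≠ 0 ∧ (c i).val ≤ N / 2 + 1

/-- Membership in the closed positive half-line. [cite: FrohlichIsraelLiebSimon1978, Thm. 2.2 (proof)] -/
@[simp] theorem mem_chalfPlus {i : Fin d} {c : BlockIdx d N} :
    c ∈ chalfPlus N i ↔ (c i).val ≠ 0 ∧ (c i).val ≤ N / 2 + 1 := by
  simp [chalfPlus]

/-- **Symmetrisation in the closed positive half-line**: `(A ∩ C₊) ∪ θ(A ∩ C₊)`, `θ = cellReflect i 1`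
(`cᵢ ↦ 1 - cᵢ`).  The fixed block, if in `A`, is kept (once). [cite: FrohlichIsraelLiebSimon1978, Thm. 2.2 (proof)] -/
def csymP (i : Fin d) (A : Finset (BlockIdx d N)) : Finset (BlockIdx d N) :=
  (A ∩ chalfPlus N i) ∪ (A ∩ chalfPlus N i).image (cellReflect i 1)

/-- The translation `cᵢ ↦ cᵢ + a` of axis `i` on block indices (Friedli–Velenik §10.2, translates `Λ_B + tB`).
[cite: FriedliVelenik2017, §10.2] -/
def cellTranslate (i : Fin d) (a : ZMod N) : BlockIdx d N ≃ BlockIdx d N where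
  toFun c := Function.update c i (c i + a)
  invFun c := Function.update c i (c i - a)
  left_inv c := by
    ext j; by_cases h : j = i
    · subst h; simp
    · simp [h]
  right_inv c := by
    ext j; by_cases h : j = i
    · subst h; simp
    · simp [h]

omit [NeZero N] in
/-- Pointwise formula for `cellTranslate`. [cite: FriedliVelenik2017, §10.2] -/
@[simp] theorem cellTranslate_apply (i : Fin d) (a : ZMod N) (c : BlockIdx d N) :
    cellTranslate i a c = Function.update c i (c i + a) := rfl

omit [NeZero N] in
/-- The `i`-th coordinate of the reflected block: `(θc)ᵢ = 1 - cᵢ` (the block reflection of Friedli–Velenik §10.2 through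
the boundary `k = 1`). [cite: FriedliVelenik2017, §10.2] -/
theorem cellReflect_one_apply_same (i : Fin d) (c : BlockIdx d N) : cellReflect i 1 c i = 1 - c i := by
  simp only [cellReflect_apply, Function.update_self]; ring

/-- **Gluing an assignment of slices**: the set of blocks whose `i`-slice through `cᵢ = t` carries the pattern `σ t`
(read modulo the `i`-th coordinate). [cite: FrohlichIsraelLiebSimon1978, Thm. 2.2 (proof)] -/
def glueSlices (i : Fin d) (σ : ZMod N → Finset (BlockIdx d N)) : Finset (BlockIdx d N) :=
  univ.filter fun c => ∃ c' ∈ σ (c i), Function.update c' i (c i) = c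

/-- Membership in `glueSlices`. [folklore] -/
private theorem mem_glue {i : Fin d} {σ : ZMod N → Finset (BlockIdx d N)} {c : BlockIdx d N} :
    c ∈ glueSlices i σ ↔ ∃ c' ∈ σ (c i), Function.update c' i (c i) = c := by
  simp [glueSlices]

/-- Gluing the slices of `A` gives back `A`. [folklore] -/
private theorem glue_slices (i : Fin d) (A : Finset (BlockIdx d N)) :
    glueSlices i (fun t => A.filter fun c => c i = t) = A := by
  ext c
  rw [mem_glue]
  constructor
  · rintro ⟨c', hc', hc⟩
    rw [mem_filter] at hc'
    obtain ⟨hc'A, hci⟩ := hc'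
    have : c' = c := by rw [← hc, ← hci, Function.update_eq_self]
    rwa [← this]
  · intro hc
    exact ⟨c, mem_filter.2 ⟨hc, rfl⟩, Function.update_eq_self _ _⟩

/-- The cylinder over the `t₀ᵢ`-slice of a set containing `boxRun t₀ m` (`m = i`) contains `boxRun t₀ (m+1)`.
[cite: FrohlichIsraelLiebSimon1978, Thm. 2.2 (proof)] -/
theorem boxRun_succ_subset_glue_const {t₀ : BlockIdx d N} (i : Fin d) {A : Finset (BlockIdx d N)}
    (hbox : boxRun t₀ i.val ⊆ A) :
    boxRun t₀ (i.val + 1) ⊆ glueSlices i (fun _ => A.filter fun c => c i = t₀ i) := by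
  intro c hc
  rw [mem_boxRun] at hc
  rw [mem_glue]
  refine ⟨Function.update c i (t₀ i), mem_filter.2 ⟨hbox ?_, by simp⟩, by simp⟩
  rw [mem_boxRun]
  intro j hj
  by_cases hji : j = i
  · subst hji; simp
  · rw [Function.update_of_ne hji]
    exact hc j (by
      have : i.val ≠ j.val := fun h => hji (Fin.ext h.symm)
      omega)

/-- Gluing a rotated assignment is translating the glued set. [folklore] -/
private theorem glue_rotate (i : Fin d) (σ : ZMod N → Finset (BlockIdx d N)) (a : ZMod N) :
    glueSlices i (fun t => σ (t + a)) = (glueSlices i σ).image (cellTranslate i (-a)) := by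
  ext c
  rw [mem_glue, mem_image]
  constructor
  · rintro ⟨c', hc', hc⟩
    refine ⟨cellTranslate i a c, ?_, ?_⟩
    · rw [mem_glue]
      refine ⟨c', ?_, ?_⟩
      · simpa using hc'
      · rw [← hc]; simp
    · ext j; by_cases h : j = i
      · subst h; simp
      · simp [h]
  · rintro ⟨b, hb, rfl⟩
    rw [mem_glue] at hb
    obtain ⟨c', hc', hb'⟩ := hb
    refine ⟨c', ?_, ?_⟩
    · simpa using hc'
    · rw [← hb']
      ext j; by_cases h : j = i
      · subst h; simp
      · simp [h]

end Blocks

/-! ### §3. Odd side `N = 2S + 1`: the symmetrisations as glued half-assignments; the exponent count -/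

section OddSide

variable {d S : ℕ}

open OddChessboard

/-- `(2S+1)/2 = S`. [folklore] -/
private theorem two_mul_add_one_div_two (S : ℕ) : (2 * S + 1) / 2 = S := by omega

/-- On the odd torus, a block lies in the closed positive half-line of axis `i` iff its `i`-th coordinate lies in the
closed positive half of the cycle. [cite: FrohlichIsraelLiebSimon1978, Thm. 2.2 (proof)] -/
theorem mem_chalfPlus_iff_cPlus {i : Fin d} {c : BlockIdx d (2 * S + 1)} :
    c ∈ chalfPlus (2 * S + 1) i ↔ c i ∈ cPlus S := by
  rw [mem_chalfPlus, mem_cPlus, two_mul_add_one_div_two]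

/-- On the odd torus, the tree's half `halfMinus N i 1 = {N/2 ≤ (cᵢ - 1).val}` is the CLOSED negative half-line
`{S+1, …, 2S, 0}`, the complement of the open positive half `{1, …, S}`. [cite: FrohlichIsraelLiebSimon1978, Thm. 2.2 (proof)] -/
theorem mem_halfMinus_one_iff_not_cMinus (hS : 1 ≤ S) {i : Fin d} {c : BlockIdx d (2 * S + 1)} :
    c ∈ halfMinus (2 * S + 1) i 1 ↔ c i ∉ cMinus S := by
  rw [mem_halfMinus, mem_cMinus, two_mul_add_one_div_two]
  have hv := val_sub_natCast (S := S) (ℓ := 1) (by omega) (c i)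
  rw [Nat.cast_one] at hv
  rw [hv]
  have := ZMod.val_lt (c i)
  split_ifs with h <;> omega

/-- Reflecting twice an `update`d block: `θ (update c' i t) = update c' i (1 - t)`. [folklore] -/
private theorem cellReflect_one_update (i : Fin d) (c' : BlockIdx d (2 * S + 1)) (t : ZMod (2 * S + 1)) :
    cellReflect i 1 (Function.update c' i t) = Function.update c' i (1 - t) := by
  ext j; by_cases h : j = i
  · subst h; simp only [cellReflect_apply, Function.update_self]; ring
  · simp [h]

/-- **Gluing the positive half-assignment is the closed positive symmetrisation of the glued set.**
[cite: FrohlichIsraelLiebSimon1978, Thm. 2.2 (proof)] -/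
theorem glue_plusHalf (hS : 1 ≤ S) (i : Fin d) (σ : ZMod (2 * S + 1) → Finset (BlockIdx d (2 * S + 1))) :
    glueSlices i (plusHalf σ) = csymP i (glueSlices i σ) := by
  ext c
  rw [csymP, mem_union, mem_inter, mem_image, mem_glue, mem_chalfPlus_iff_cPlus]
  constructor
  · rintro ⟨c', hc', hc⟩
    by_cases hp : c i ∈ cPlus S
    · rw [plusHalf, if_pos hp] at hc'
      exact Or.inl ⟨mem_glue.2 ⟨c', hc', hc⟩, hp⟩
    · rw [plusHalf, if_neg hp] at hc'
      refine Or.inr ⟨cellReflect i 1 c, mem_inter.2 ⟨?_, ?_⟩, cellReflect_cellReflect i 1 c⟩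
      · rw [mem_glue, cellReflect_one_apply_same]
        refine ⟨c', hc', ?_⟩
        rw [← hc, cellReflect_one_update, Function.update_self]
      · rw [mem_chalfPlus_iff_cPlus, cellReflect_one_apply_same]
        exact cPlus_of_cMinus (one_sub_mem_cMinus_of_not_mem_cPlus hS hp)
  · rintro (⟨hc, hp⟩ | ⟨b, hb, rfl⟩)
    · obtain ⟨c', hc', hc⟩ := mem_glue.1 hc
      exact ⟨c', by rw [plusHalf, if_pos hp]; exact hc', hc⟩
    · obtain ⟨hb, hbp⟩ := mem_inter.1 hb
      rw [mem_chalfPlus_iff_cPlus] at hbp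
      obtain ⟨b', hb', hbb⟩ := mem_glue.1 hb
      by_cases hbm : b i ∈ cMinus S
      · have hnot : cellReflect i 1 b i ∉ cPlus S := by
          rw [cellReflect_one_apply_same]; exact one_sub_not_mem_cPlus_of_mem_cMinus hS hbm
        refine ⟨b', ?_, ?_⟩
        · rw [plusHalf, if_neg hnot, cellReflect_one_apply_same, sub_sub_cancel]; exact hb'
        · rw [cellReflect_one_apply_same, ← hbb, cellReflect_one_update, Function.update_self]
      · have hfix : (1 : ZMod (2 * S + 1)) - b i = b i := one_sub_eq_self hS hbp hbm
        have hθ : cellReflect i 1 b = b := by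
          ext j; by_cases h : j = i
          · subst h; rw [cellReflect_one_apply_same, hfix]
          · exact cellReflect_apply_of_ne i 1 b h
        rw [hθ]
        exact ⟨b', by rw [plusHalf, if_pos hbp]; exact hb', hbb⟩

/-- **Gluing the negative half-assignment is the tree's negative symmetrisation `symM i 1` of the glued set.**
[cite: FrohlichIsraelLiebSimon1978, Thm. 2.2 (proof)] -/
theorem glue_minusHalf (hS : 1 ≤ S) (i : Fin d) (σ : ZMod (2 * S + 1) → Finset (BlockIdx d (2 * S + 1))) :
    glueSlices i (minusHalf σ) = symM i 1 (glueSlices i σ) := by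
  ext c
  rw [symM, mem_union, mem_inter, mem_image, mem_glue, mem_halfMinus_one_iff_not_cMinus hS]
  constructor
  · rintro ⟨c', hc', hc⟩
    by_cases hm : c i ∈ cMinus S
    · rw [minusHalf, if_pos hm] at hc'
      refine Or.inr ⟨cellReflect i 1 c, mem_inter.2 ⟨?_, ?_⟩, cellReflect_cellReflect i 1 c⟩
      · rw [mem_glue, cellReflect_one_apply_same]
        refine ⟨c', hc', ?_⟩
        rw [← hc, cellReflect_one_update, Function.update_self]
      · rw [mem_halfMinus_one_iff_not_cMinus hS, cellReflect_one_apply_same]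
        exact fun h => one_sub_not_mem_cPlus_of_mem_cMinus hS hm (cPlus_of_cMinus h)
    · rw [minusHalf, if_neg hm] at hc'
      exact Or.inl ⟨mem_glue.2 ⟨c', hc', hc⟩, hm⟩
  · rintro (⟨hc, hm⟩ | ⟨b, hb, rfl⟩)
    · obtain ⟨c', hc', hc⟩ := mem_glue.1 hc
      exact ⟨c', by rw [minusHalf, if_neg hm]; exact hc', hc⟩
    · obtain ⟨hb, hbm⟩ := mem_inter.1 hb
      rw [mem_halfMinus_one_iff_not_cMinus hS] at hbm
      obtain ⟨b', hb', hbb⟩ := mem_glue.1 hb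
      by_cases hbp : b i ∈ cPlus S
      · have hfix : (1 : ZMod (2 * S + 1)) - b i = b i := one_sub_eq_self hS hbp hbm
        have hθ : cellReflect i 1 b = b := by
          ext j; by_cases h : j = i
          · subst h; rw [cellReflect_one_apply_same, hfix]
          · exact cellReflect_apply_of_ne i 1 b h
        rw [hθ]
        exact ⟨b', by rw [minusHalf, if_neg hbm]; exact hb', hbb⟩
      · have hmem : cellReflect i 1 b i ∈ cMinus S := by
          rw [cellReflect_one_apply_same]; exact one_sub_mem_cMinus_of_not_mem_cPlus hS hbp
        refine ⟨b', ?_, ?_⟩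
        · rw [minusHalf, if_pos hmem, cellReflect_one_apply_same, sub_sub_cancel]; exact hb'
        · rw [cellReflect_one_apply_same, ← hbb, cellReflect_one_update, Function.update_self]

/-- The fixed slice `cᵢ = S + 1` of a set of blocks (the blocks on the site hyperplane fixed by the reflection).
[cite: FrohlichIsraelLiebSimon1978, Thm. 2.2 (proof)] -/
def fixedSlice (i : Fin d) (A : Finset (BlockIdx d (2 * S + 1))) : Finset (BlockIdx d (2 * S + 1)) :=
  A.filter fun c => (c i).val = S + 1

/-- A block of the fixed slice is fixed by the reflection. [folklore] -/
private theorem cellReflect_one_eq_self_of_val (hS : 1 ≤ S) {i : Fin d} {c : BlockIdx d (2 * S + 1)}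
    (hc : (c i).val = S + 1) : cellReflect i 1 c = c := by
  have hp : c i ∈ cPlus S := mem_cPlus.2 ⟨by omega, by omega⟩
  have hm : c i ∉ cMinus S := fun h => by rw [mem_cMinus] at h; omega
  ext j; by_cases h : j = i
  · subst h; rw [cellReflect_one_apply_same, one_sub_eq_self hS hp hm]
  · exact cellReflect_apply_of_ne i 1 c h

/-- The overlap of `A ∩ C₊` with its reflection is the fixed slice of `A`. [folklore] -/
private theorem inter_chalfPlus_inter_image (hS : 1 ≤ S) (i : Fin d) (A : Finset (BlockIdx d (2 * S + 1))) :
    (A ∩ chalfPlus (2 * S + 1) i) ∩ (A ∩ chalfPlus (2 * S + 1) i).image (cellReflect i 1) = fixedSlice i A := by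
  ext c
  rw [mem_inter, mem_inter, mem_image, fixedSlice, mem_filter, mem_chalfPlus_iff_cPlus]
  constructor
  · rintro ⟨⟨hcA, hcp⟩, b, hb, rfl⟩
    rw [mem_inter, mem_chalfPlus_iff_cPlus] at hb
    rw [cellReflect_one_apply_same] at hcp
    refine ⟨hcA, ?_⟩
    by_cases hbm : b i ∈ cMinus S
    · exact absurd hcp (one_sub_not_mem_cPlus_of_mem_cMinus hS hbm)
    · rw [cellReflect_one_apply_same, one_sub_eq_self hS hb.2 hbm]
      have h1 := mem_cPlus.1 hb.2; have h2 := hbm; rw [mem_cMinus] at h2; omega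
  · rintro ⟨hcA, hcv⟩
    have hp : c i ∈ cPlus S := mem_cPlus.2 ⟨by omega, by omega⟩
    exact ⟨⟨hcA, hp⟩, c, mem_inter.2 ⟨hcA, mem_chalfPlus_iff_cPlus.2 hp⟩,
      cellReflect_one_eq_self_of_val hS hcv⟩

/-- The overlap of `A ∩ H₋` with its reflection is the fixed slice of `A`. [folklore] -/
private theorem inter_halfMinus_inter_image (hS : 1 ≤ S) (i : Fin d) (A : Finset (BlockIdx d (2 * S + 1))) :
    (A ∩ halfMinus (2 * S + 1) i 1) ∩ (A ∩ halfMinus (2 * S + 1) i 1).image (cellReflect i 1) =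
      fixedSlice i A := by
  ext c
  rw [mem_inter, mem_inter, mem_image, fixedSlice, mem_filter, mem_halfMinus_one_iff_not_cMinus hS]
  constructor
  · rintro ⟨⟨hcA, hcm⟩, b, hb, rfl⟩
    rw [mem_inter, mem_halfMinus_one_iff_not_cMinus hS] at hb
    rw [cellReflect_one_apply_same] at hcm
    refine ⟨hcA, ?_⟩
    by_cases hbp : b i ∈ cPlus S
    · rw [cellReflect_one_apply_same, one_sub_eq_self hS hbp hb.2]
      have h1 := mem_cPlus.1 hbp; have h2 := hb.2; rw [mem_cMinus] at h2; omega
    · exact absurd (one_sub_mem_cMinus_of_not_mem_cPlus hS hbp) hcm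
  · rintro ⟨hcA, hcv⟩
    have hm : c i ∉ cMinus S := fun h => by rw [mem_cMinus] at h; omega
    exact ⟨⟨hcA, hm⟩, c, mem_inter.2 ⟨hcA, (mem_halfMinus_one_iff_not_cMinus hS).2 hm⟩,
      cellReflect_one_eq_self_of_val hS hcv⟩

/-- **The exponents match in the Cauchy–Schwarz step on an odd torus**: `#csymP i A + #symM i 1 A = 2 #A`
(each closed half-symmetrisation double-counts its half and keeps the fixed slice once; the two closed halves
overlap exactly in the fixed slice). [cite: FrohlichIsraelLiebSimon1978, Thm. 2.2 (proof)] -/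
theorem card_csymP_add_card_symM_odd (hS : 1 ≤ S) (i : Fin d) (A : Finset (BlockIdx d (2 * S + 1))) :
    #(csymP i A) + #(symM i 1 A) = 2 * #A := by
  have hP : #(csymP i A) + #(fixedSlice i A) =
      #(A ∩ chalfPlus (2 * S + 1) i) + #(A ∩ chalfPlus (2 * S + 1) i) := by
    rw [csymP, ← inter_chalfPlus_inter_image hS i A, card_union_add_card_inter,
      card_image_of_injective _ (cellReflect i 1).injective]
  have hM : #(symM i 1 A) + #(fixedSlice i A) =
      #(A ∩ halfMinus (2 * S + 1) i 1) + #(A ∩ halfMinus (2 * S + 1) i 1) := by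
    rw [symM, ← inter_halfMinus_inter_image hS i A, card_union_add_card_inter,
      card_image_of_injective _ (cellReflect i 1).injective]
  have hU : #(A ∩ chalfPlus (2 * S + 1) i) + #(A ∩ halfMinus (2 * S + 1) i 1) = #A + #(fixedSlice i A) := by
    rw [← card_union_add_card_inter]
    congr 1
    · congr 1
      ext c
      rw [mem_union, mem_inter, mem_inter, mem_chalfPlus_iff_cPlus, mem_halfMinus_one_iff_not_cMinus hS]
      constructor
      · rintro (⟨h, _⟩ | ⟨h, _⟩) <;> exact h
      · intro h
        by_cases hp : c i ∈ cPlus S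
        · exact Or.inl ⟨h, hp⟩
        · exact Or.inr ⟨h, fun hm => hp (cPlus_of_cMinus hm)⟩
    · congr 1
      ext c
      rw [mem_inter, mem_inter, mem_inter, mem_chalfPlus_iff_cPlus, mem_halfMinus_one_iff_not_cMinus hS,
        fixedSlice, mem_filter, mem_cPlus, mem_cMinus]
      constructor
      · rintro ⟨⟨h, h1, h2⟩, _, h3⟩; exact ⟨h, by omega⟩
      · rintro ⟨h, hv⟩; exact ⟨⟨h, by omega, by omega⟩, h, by omega⟩
  omega

end OddSide

/-! ### §4. The extremal argument and the chessboard estimate for odd sides -/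

section Extremal

variable {d S : ℕ}

open OddChessboard

/-- **The Cauchy–Schwarz inequality passes to `Φ` on an odd torus**: `Φ A ^ 2 ≤ Φ (csymP i A) Φ (symM i 1 A)`,
because `#csymP i A + #symM i 1 A = 2 #A`. [cite: FrohlichIsraelLiebSimon1978, Thm. 2.2 (proof)] -/
theorem chessPhi_sq_le_odd (hS : 1 ≤ S) {ψ : Finset (BlockIdx d (2 * S + 1)) → ℝ} (h1 : 0 < ψ univ)
    (hcs : ∀ (i : Fin d) (A : Finset (BlockIdx d (2 * S + 1))),
      ψ A ^ 2 ≤ ψ (csymP i A) * ψ (symM i 1 A))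
    (i : Fin d) (A : Finset (BlockIdx d (2 * S + 1))) :
    chessPhi ψ A ^ 2 ≤ chessPhi ψ (csymP i A) * chessPhi ψ (symM i 1 A) := by
  have hpow : (ψ A ^ (2 * S + 1) ^ d) ^ 2 ≤
      ψ (csymP i A) ^ (2 * S + 1) ^ d * ψ (symM i 1 A) ^ (2 * S + 1) ^ d := by
    rw [← pow_mul, mul_comm, pow_mul, ← mul_pow]
    exact pow_le_pow_left₀ (sq_nonneg _) (hcs i A) _
  have hden : ψ univ ^ #(csymP i A) * ψ univ ^ #(symM i 1 A) = (ψ univ ^ #A) ^ 2 := by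
    rw [← pow_add, card_csymP_add_card_symM_odd hS, pow_mul']
  simp only [chessPhi, div_pow]
  rw [div_mul_div_comm, hden]
  exact div_le_div_of_nonneg_right hpow (by positivity)

/-- **The closed positive symmetrisation of a maximiser of `Φ` is a maximiser** (odd side).
[cite: FrohlichIsraelLiebSimon1978, Thm. 2.2 (proof)] -/
theorem chessPhi_csymP_eq_of_isMax_odd (hS : 1 ≤ S) {ψ : Finset (BlockIdx d (2 * S + 1)) → ℝ}
    (h0 : ∀ A, 0 ≤ ψ A) (h1 : 0 < ψ univ)
    (hcs : ∀ (i : Fin d) (A : Finset (BlockIdx d (2 * S + 1))),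
      ψ A ^ 2 ≤ ψ (csymP i A) * ψ (symM i 1 A))
    {M : ℝ} (hMpos : 0 < M) (hmax : ∀ A, chessPhi ψ A ≤ M) {A : Finset (BlockIdx d (2 * S + 1))}
    (hA : chessPhi ψ A = M) (i : Fin d) :
    chessPhi ψ (csymP i A) = M := by
  have hP0 : 0 ≤ chessPhi ψ (csymP i A) := by
    unfold chessPhi; exact div_nonneg (pow_nonneg (h0 _) _) (pow_nonneg h1.le _)
  have hM0 : 0 ≤ chessPhi ψ (symM i 1 A) := by
    unfold chessPhi; exact div_nonneg (pow_nonneg (h0 _) _) (pow_nonneg h1.le _)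
  have h := chessPhi_sq_le_odd hS h1 hcs i A
  rw [hA] at h
  have hMle := hmax (symM i 1 A)
  refine le_antisymm (hmax _) ?_
  by_contra hlt
  rw [not_le] at hlt
  have h1' : chessPhi ψ (csymP i A) * chessPhi ψ (symM i 1 A) ≤ chessPhi ψ (csymP i A) * M :=
    mul_le_mul_of_nonneg_left hMle hP0
  have h2' : chessPhi ψ (csymP i A) * M < M * M := mul_lt_mul_of_pos_right hlt hMpos
  nlinarith

/-- `Φ` is invariant under the translations of an axis when `ψ` is. [folklore] -/
private theorem chessPhi_image_cellTranslate {N : ℕ} [NeZero N] {ψ : Finset (BlockIdx d N) → ℝ}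
    (htr : ∀ (i : Fin d) (a : ZMod N) (A : Finset (BlockIdx d N)), ψ (A.image (cellTranslate i a)) = ψ A)
    (i : Fin d) (a : ZMod N) (A : Finset (BlockIdx d N)) :
    chessPhi ψ (A.image (cellTranslate i a)) = chessPhi ψ A := by
  rw [chessPhi, chessPhi, htr, card_image_of_injective _ (cellTranslate i a).injective]

/-- **Growing a maximiser along one axis of an odd torus**: if a maximiser contains `boxRun t₀ i` then some
maximiser contains `boxRun t₀ (i+1)` — the run-doubling walk applied to the assignment of `i`-slices of the maximiser,
whose constant assignments are maximisers and are cylinders over single slices.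
[cite: FrohlichIsraelLiebSimon1978, Thm. 2.2 (proof)] -/
theorem exists_isMax_boxRun_succ_odd (hS : 1 ≤ S) {ψ : Finset (BlockIdx d (2 * S + 1)) → ℝ}
    (h0 : ∀ A, 0 ≤ ψ A) (h1 : 0 < ψ univ)
    (htr : ∀ (i : Fin d) (a : ZMod (2 * S + 1)) (A : Finset (BlockIdx d (2 * S + 1))),
      ψ (A.image (cellTranslate i a)) = ψ A)
    (hcs : ∀ (i : Fin d) (A : Finset (BlockIdx d (2 * S + 1))),
      ψ A ^ 2 ≤ ψ (csymP i A) * ψ (symM i 1 A))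
    {M : ℝ} (hMpos : 0 < M) (hmax : ∀ A, chessPhi ψ A ≤ M) {t₀ : BlockIdx d (2 * S + 1)} (i : Fin d)
    {A : Finset (BlockIdx d (2 * S + 1))} (hA : chessPhi ψ A = M) (hbox : boxRun t₀ i.val ⊆ A) :
    ∃ A' : Finset (BlockIdx d (2 * S + 1)), chessPhi ψ A' = M ∧ boxRun t₀ (i.val + 1) ⊆ A' := by
  have key := walk hS
    (P := fun σ : ZMod (2 * S + 1) → Finset (BlockIdx d (2 * S + 1)) => chessPhi ψ (glueSlices i σ) = M)
    (fun σ hσ => by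
      show chessPhi ψ (glueSlices i (plusHalf σ)) = M
      rw [glue_plusHalf hS]
      exact chessPhi_csymP_eq_of_isMax_odd hS h0 h1 hcs hMpos hmax hσ i)
    (fun σ a hσ => by
      show chessPhi ψ (glueSlices i fun t => σ (t + a)) = M
      rw [glue_rotate, chessPhi_image_cellTranslate htr]
      exact hσ)
    (σ := fun t => A.filter fun c => c i = t) (by show chessPhi ψ (glueSlices i _) = M; rw [glue_slices]; exact hA)
    (t₀ i)
  exact ⟨_, key, boxRun_succ_subset_glue_const i hbox⟩

/-- **The chessboard estimate, power form, on the block torus of odd side `2S+1`, `S ≥ 1`.**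
[cite: FrohlichIsraelLiebSimon1978, Thm. 4.1 (maximisation proof of Thm. 2.2, odd period)] -/
theorem chessboard_pow_le_odd' (hS : 1 ≤ S) {ψ : Finset (BlockIdx d (2 * S + 1)) → ℝ}
    (h0 : ∀ A, 0 ≤ ψ A) (hempty : ψ ∅ ≤ 1) (h1 : 0 < ψ univ)
    (htr : ∀ (i : Fin d) (a : ZMod (2 * S + 1)) (A : Finset (BlockIdx d (2 * S + 1))),
      ψ (A.image (cellTranslate i a)) = ψ A)
    (hcs : ∀ (i : Fin d) (A : Finset (BlockIdx d (2 * S + 1))),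
      ψ A ^ 2 ≤ ψ (csymP i A) * ψ (symM i 1 A))
    (A : Finset (BlockIdx d (2 * S + 1))) : ψ A ^ ((2 * S + 1) ^ d) ≤ ψ univ ^ #A := by
  classical
  obtain ⟨Amax, -, hAmax⟩ :=
    Finset.exists_max_image (univ : Finset (Finset (BlockIdx d (2 * S + 1)))) (chessPhi ψ) ⟨∅, mem_univ _⟩
  set M := chessPhi ψ Amax with hM
  have hmax : ∀ T, chessPhi ψ T ≤ M := fun T => hAmax T (mem_univ T)
  have hM1 : 1 ≤ M := by rw [← chessPhi_univ h1]; exact hmax _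
  have hMpos : 0 < M := one_pos.trans_le hM1
  have hMle : M ≤ 1 := by
    by_cases hne : Amax = ∅
    · rw [hM, hne, chessPhi, card_empty, pow_zero, div_one]
      exact pow_le_one₀ (h0 _) hempty
    · obtain ⟨t₀, ht₀⟩ := Finset.nonempty_iff_ne_empty.2 hne
      have grow : ∀ m : ℕ, m ≤ d →
          ∃ A' : Finset (BlockIdx d (2 * S + 1)), chessPhi ψ A' = M ∧ boxRun t₀ m ⊆ A' := by
        intro m
        induction m with
        | zero =>
          exact fun _ => ⟨Amax, rfl, by rw [boxRun_zero]; exact singleton_subset_iff.2 ht₀⟩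
        | succ m ih =>
          intro hm
          obtain ⟨A', hA', hbox⟩ := ih (Nat.le_of_succ_le hm)
          exact exists_isMax_boxRun_succ_odd hS h0 h1 htr hcs hMpos hmax ⟨m, hm⟩ hA' hbox
      obtain ⟨A', hA', hbox⟩ := grow d le_rfl
      rw [boxRun_eq_univ] at hbox
      have : A' = univ := univ_subset_iff.1 hbox
      rw [← hA', this, chessPhi_univ h1]
  have hA : chessPhi ψ A ≤ 1 := (hmax A).trans hMle
  rw [chessPhi, div_le_one (pow_pos h1 _)] at hA
  exact hA

end Extremal

/-! ### §5. The theorems for every odd side `N ≥ 3` -/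

section Main

variable {d N : ℕ} [NeZero N]

/-- **The chessboard estimate, power form, for every ODD side `N ≥ 3`** (Fröhlich–Israel–Lieb–Simon 1978, Thm. 4.1,
by the maximisation argument of their Thm. 2.2, which needs no parity): if `ψ ≥ 0`, `ψ ∅ ≤ 1`, `ψ univ > 0`, `ψ` is
invariant under the translations of every axis, and `ψ A ^ 2 ≤ ψ (csymP i A) ψ (symM i 1 A)` for every axis `i` and
every `A` (reflection `cᵢ ↦ 1 - cᵢ`, CLOSED half-lines), then `ψ A ^ (N^d) ≤ ψ univ ^ #A`.
[cite: FrohlichIsraelLiebSimon1978, Thm. 4.1 (maximisation proof of Thm. 2.2, odd period)] -/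
theorem chessboard_pow_le_odd (hN : Odd N) (h3 : 3 ≤ N) {ψ : Finset (BlockIdx d N) → ℝ}
    (h0 : ∀ A, 0 ≤ ψ A) (hempty : ψ ∅ ≤ 1) (h1 : 0 < ψ univ)
    (htr : ∀ (i : Fin d) (a : ZMod N) (A : Finset (BlockIdx d N)), ψ (A.image (cellTranslate i a)) = ψ A)
    (hcs : ∀ (i : Fin d) (A : Finset (BlockIdx d N)), ψ A ^ 2 ≤ ψ (csymP i A) * ψ (symM i 1 A))
    (A : Finset (BlockIdx d N)) : ψ A ^ (N ^ d) ≤ ψ univ ^ #A := by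
  obtain ⟨S, rfl⟩ := hN
  exact chessboard_pow_le_odd' (by omega) h0 hempty h1 htr hcs A

/-- **The chessboard estimate for every odd side `N ≥ 3`**, usual form `ψ A ≤ (ψ univ) ^ (#A / N^d)`.
[cite: FrohlichIsraelLiebSimon1978, Thm. 4.1 (maximisation proof of Thm. 2.2, odd period)] -/
theorem chessboard_le_rpow_odd (hN : Odd N) (h3 : 3 ≤ N) {ψ : Finset (BlockIdx d N) → ℝ}
    (h0 : ∀ A, 0 ≤ ψ A) (hempty : ψ ∅ ≤ 1) (h1 : 0 < ψ univ)
    (htr : ∀ (i : Fin d) (a : ZMod N) (A : Finset (BlockIdx d N)), ψ (A.image (cellTranslate i a)) = ψ A)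
    (hcs : ∀ (i : Fin d) (A : Finset (BlockIdx d N)), ψ A ^ 2 ≤ ψ (csymP i A) * ψ (symM i 1 A))
    (A : Finset (BlockIdx d N)) : ψ A ≤ ψ univ ^ ((#A : ℝ) / (N : ℝ) ^ d) := by
  have hNd : (0 : ℝ) < (N : ℝ) ^ d := by
    have : (0 : ℝ) < N := by exact_mod_cast Nat.pos_of_ne_zero (NeZero.ne N)
    positivity
  have h := chessboard_pow_le_odd hN h3 h0 hempty h1 htr hcs A
  have hroot : ψ A = (ψ A ^ (N ^ d)) ^ ((1 : ℝ) / (N : ℝ) ^ d) := by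
    rw [← Real.rpow_natCast, ← Real.rpow_mul (h0 A)]
    push_cast
    rw [mul_one_div_cancel hNd.ne', Real.rpow_one]
  rw [hroot]
  calc (ψ A ^ N ^ d) ^ ((1 : ℝ) / (N : ℝ) ^ d)
      ≤ (ψ univ ^ #A) ^ ((1 : ℝ) / (N : ℝ) ^ d) :=
        Real.rpow_le_rpow (pow_nonneg (h0 A) _) h (by positivity)
    _ = ψ univ ^ ((#A : ℝ) / (N : ℝ) ^ d) := by
        rw [← Real.rpow_natCast, ← Real.rpow_mul h1.le]
        congr 1
        ring

/-- **Product form** for a family of `[0,1]`-valued functionals read as probabilities of "all blocks of `A` are bad":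
`ψ A ≤ δ ^ #A` with `δ = (ψ univ) ^ (1 / N^d)` — the HEREDITARY form consumed by Peierls–chessboard arguments.
[cite: FrohlichIsraelLiebSimon1978, Thm. 4.1 (maximisation proof of Thm. 2.2, odd period)] -/
theorem chessboard_le_pow_odd (hN : Odd N) (h3 : 3 ≤ N) {ψ : Finset (BlockIdx d N) → ℝ}
    (h0 : ∀ A, 0 ≤ ψ A) (hempty : ψ ∅ ≤ 1) (h1 : 0 < ψ univ)
    (htr : ∀ (i : Fin d) (a : ZMod N) (A : Finset (BlockIdx d N)), ψ (A.image (cellTranslate i a)) = ψ A)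
    (hcs : ∀ (i : Fin d) (A : Finset (BlockIdx d N)), ψ A ^ 2 ≤ ψ (csymP i A) * ψ (symM i 1 A))
    (A : Finset (BlockIdx d N)) : ψ A ≤ (ψ univ ^ ((1 : ℝ) / (N : ℝ) ^ d)) ^ #A := by
  rw [← Real.rpow_natCast, ← Real.rpow_mul h1.le]
  convert chessboard_le_rpow_odd hN h3 h0 hempty h1 htr hcs A using 2
  ring

end Main

end Literature.Probability.LatticeModels

end
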